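import Summits.QuantumFields.YangMills.Theorems.LuscherReductionTwistedTraceScalingBODefectOutSchur
import Summits.QuantumFields.YangMills.Theorems.LuscherReductionTwistedTraceScalingBOMassRatioHodge
import Summits.QuantumFields.YangMills.Theorems.LuscherReductionTwistedTraceScalingBODualProfile
import Summits.QuantumFields.YangMills.Theorems.LuscherReductionTwistedTraceScalingBOCapProfile
import Summits.QuantumFields.YangMills.Theorems.LuscherReductionTwistedTraceScalingColourAverage
import Summits.QuantumFields.YangMills.Theorems.LuscherReductionTwistedTraceScalingRecordBricks
import HarnessLib

/-!
# (C5-O) ★★★ THE OUTER PIECE OF THE hOD DEFECT, REDUCED TO STIFF SEPARATION: `∫ 𝟙_{S∖S_in}·F²/w ≤ 3π(univ)/(N̄(1−κ_P))·(e^{4β|E|}(e^{−β·gap·R₀²/4} + 2e^{−τ²/ε²}) + e^{2β|E|}K_sep)·‖φ‖²`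
# (lane A of S-BASE, crux `TwistedTraceScaling` stmt-QuantumFields-20203, C4-CORE, the (OD) pen; piece `I_out` of `…BODefectSplit`, `pub/ym-fleet/ym-luscher-20007-p1/HANDOFF-g20.md`)

`F = K̃(φ⊗Ω_c)` on the outer region `S_out = orthoTubeSet ∩ {χ ≠ 0} ∩ {‖relLinkVec‖ > R₀}` (`R₀ = r_f/12`).  Split the PROFILE `Ω_c = Ω_out + Ω_gf + Ω_in` (fibre shell `‖x‖ > R₀/2`;
inner gauge-far `‖x‖ ≤ R₀/2, ‖P_Γx‖ > τ`; inner gauge-near), so `F = F_out + F_gf + F_in`, and the WEIGHT `g = 𝟙_{S_out}/w = g_near + g_far` by `‖P_Γ relLinkVec U‖ ≤ τ` or not.  By the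
weighted Schur test (`…BODefectOutSchur.schur_avgKernel_restricted_le`, `K̃ ≤ e^{2β|E|}`, `1/w ≤ 1/(N̄(1−κ_P))` on `supp χ`):
* `∫ g·F_out² ≤ e^{4β|E|}/(N̄(1−κ_P))·π(univ)·e^{−β·gap·(R₀/2)²}·∫φ²` — the profile shell is pointwise tiny (`…BOMassRatio.shell_integrand_le_of_hodge` + (H));
* `∫ g·F_gf² ≤ e^{4β|E|}/(N̄(1−κ_P))·π(univ)·e^{−2τ²/ε²}·∫φ²` — `Ω_c ≤ e^{−‖P_Γx‖²/ε²}`;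
* `∫ g_far·F_in² ≤ e^{4β|E|}·e^{−τ²/ε²}/(N̄(1−κ_P))·π(univ)·∫φ²` — `χ ≤ e^{−‖P_Γx'‖²/ε²}` in `1/w = χ/N`;
* `∫ g_near·F_in² ≤ e^{2β|E|}·K_sep/(N̄(1−κ_P))·π(univ)·∫φ²` — GIVEN the STIFF-SEPARATION kernel bound `K̃_β(U,V) ≤ K_sep` for `U ∈ S_out` gauge-near and `V` in the inner
  gauge-near tube `V_in = orthoTubeSet ∩ {‖relLinkVec‖ ≤ R₀/2} ∩ {‖P_Γ relLinkVec‖ ≤ τ} ∩ {slowMean in the slow window}` (hypothesis `hsep`; COARSE-DESIGN §30.6 (d)).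
★★★ `out_sq_integral_le_of_sep` — the displayed bound (β-pointwise).  What remains of (C5) after this file is EXACTLY the kernel estimate `hsep` with
`K_sep = e^{2β|E|}·e^{−c·β·r_f²}` eventually (stiff separation), plus the eventual bookkeeping of the hOD assembly.
HONEST FRAMING: a reduction for a stub of a child of the CONDITIONAL route R2b1; stiff separation, the hOD assembly, (B-ST), C4-CORE OPEN; not infinite volume, not a gap, not Clay.
-/

set_option autoImplicit false

noncomputable section

open MeasureTheory Filter Topology Real
open scoped BigOperators RealInnerProductSpace
open Literature.MathematicalPhysics.QuantumFieldTheory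
open Literature.MathematicalPhysics.QuantumLattice

namespace Summit.QuantumFields.YangMills.Theorems.FemtoTransferGap.TwoLattice.ConstTube

open Summit.QuantumFields.YangMills.Theorems.FemtoTransferGap
open Summit.QuantumFields.YangMills.Theorems.FemtoTransferGap.TwoLattice
open Summit.QuantumFields.YangMills.Theorems.FemtoTransferGap.TwoLattice.Avg
open Summit.QuantumFields.YangMills.Theorems.FemtoTransferGap.TwoLattice.Stiff
open Summit.QuantumFields.YangMills.Theorems.FemtoTransferGap.TwoLattice.GnChart

variable {L : ℕ} [NeZero L]

/-! ## §1 The column bound for a weight bounded by a constant -/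

/-- `∫ K̃(U,V)·g(U) dU ≤ e^{2β|E|}·c` when `0 ≤ g ≤ c`. [folklore] -/
theorem integral_avgKernel_mul_le_of_le {β : ℝ} (hβ : 0 ≤ β) {g : GaugeConfig 3 L SU2 → ℝ} (hg0 : ∀ U, 0 ≤ g U) {c : ℝ} (hgc : ∀ U, g U ≤ c) (V : GaugeConfig 3 L SU2) :
    ∫ U, avgKernel β U V * g U ∂configMeasure SU2 L ≤ Real.exp (2 * β) ^ Fintype.card (Edge 3 L) * c := by
  have hc0 : 0 ≤ c := (hg0 1).trans (hgc 1)
  have h := integral_mono_of_nonneg (μ := configMeasure SU2 L) (ae_of_all _ fun U => mul_nonneg (avgKernel_pos β U V).le (hg0 U))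
    (integrable_const (Real.exp (2 * β) ^ Fintype.card (Edge 3 L) * c))
    (ae_of_all _ fun U => mul_le_mul (avgKernel_le_expCard hβ U V) (hgc U) (hg0 U) (by positivity))
  simpa [integral_const] using h

/-- `∫ K̃(U,V)·g(U) dU ≤ K·c` when `0 ≤ g ≤ c` and `K̃(U,V) ≤ K` wherever `g(U) ≠ 0` (`K ≥ 0`). [folklore] -/
theorem integral_avgKernel_mul_le_of_sep {β : ℝ} {g : GaugeConfig 3 L SU2 → ℝ} (hg0 : ∀ U, 0 ≤ g U) {c : ℝ} (hgc : ∀ U, g U ≤ c) {K : ℝ} (hK : 0 ≤ K)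
    (V : GaugeConfig 3 L SU2) (hsep : ∀ U, g U ≠ 0 → avgKernel β U V ≤ K) :
    ∫ U, avgKernel β U V * g U ∂configMeasure SU2 L ≤ K * c := by
  have hc0 : 0 ≤ c := (hg0 1).trans (hgc 1)
  have hpt : ∀ U, avgKernel β U V * g U ≤ K * c := fun U => by
    by_cases h : g U = 0
    · rw [h, mul_zero]; positivity
    · exact mul_le_mul (hsep U h) (hgc U) (hg0 U) hK
  have h := integral_mono_of_nonneg (μ := configMeasure SU2 L) (ae_of_all _ fun U => mul_nonneg (avgKernel_pos β U V).le (hg0 U)) (integrable_const (K * c))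
    (ae_of_all _ hpt)
  simpa [integral_const] using h

/-! ## §2 ★★★ The outer piece, reduced to the stiff-separation kernel bound -/

set_option maxHeartbeats 1600000 in
-- a long assembly (three profile pieces × two weight pieces, four Schur instances) over the explicit record profile and weight.
/-- ★★★ **THE OUTER PIECE OF THE hOD DEFECT, MODULO STIFF SEPARATION** (see the module docstring): β-pointwise, for `β ≥ max(1, gap)`, `L ≥ 2`, the (P) floor
`N ≥ N̄(1−κ_P) > 0` on the fat tube, `φ` bounded measurable supported in the slow window `‖q(u_k)−1‖ ≤ δ`, radii `R₀ ≥ 0`, `τ ≥ 0`, and the kernel bound `hsep` with `K_sep ≥ 0`.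
[cite: Luscher1983, §3] [cite: Helffer2013, Lemma 7.1] -/
theorem out_sq_integral_le_of_sep (hL : 2 ≤ L) {β : ℝ} (hβ : 1 ≤ β) (hβg : 2 - 2 * Real.cos (2 * Real.pi / L) ≤ β) {s M δ Nbar κP : ℝ} (hNκ : 0 < Nbar * (1 - κP))
    (hPlo : ∀ U ∈ fatTubeRho L (fun β => 43 * powScale s β) (fun b => M * (43 * powScale s b)) β, Nbar * (1 - κP) ≤ gaugeAvg (recordChi L s 43 M β) U)
    {φ : GaugeConfig 3 1 SU2 → ℝ} (hφm : Measurable φ) {Cφ : ℝ} (hCφ : ∀ u, |φ u| ≤ Cφ) (hφw : ∀ u, φ u ≠ 0 → ∀ k : Fin 3, ‖su2Quat (u (0, k)) - 1‖ ≤ δ)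
    {R₀ τ Ksep : ℝ} (hR₀ : 0 ≤ R₀) (hτ : 0 ≤ τ) (hKsep : 0 ≤ Ksep)
    (hsep : ∀ U ∈ orthoTubeSet L ∩ {U | (recordChi L s 43 M β) U ≠ 0} ∩ {U | R₀ < ‖relLinkVec L U‖}, ‖(gaugeModes L).starProjection (relLinkVec L U)‖ ≤ τ →
      ∀ V ∈ orthoTubeSet L ∩ {V | ‖relLinkVec L V‖ ≤ R₀ / 2} ∩ {V | ‖(gaugeModes L).starProjection (relLinkVec L V)‖ ≤ τ} ∩
        {V | ∀ k : Fin 3, ‖su2Quat (slowMean L V (0, k)) - 1‖ ≤ δ}, avgKernel β U V ≤ Ksep) :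
    ∫ U, (orthoTubeSet L ∩ {U | (recordChi L s 43 M β) U ≠ 0} ∩ {U | R₀ < ‖relLinkVec L U‖}).indicator (fun _ => (1 : ℝ)) U *
        ((∫ V, avgKernel β U V * boFun L φ (fun x : LinkSpace L => {x : LinkSpace L | linkCurry x ∈ capBalancedSet L}.indicator (fun _ => (1 : ℝ)) x * frozenProfile L (fun β' => stiffGaussExp L (β' / 2) β') (fun β' => min (1 / 40) (powScale (1 / 2) β' * btLog β')) β x) V ∂configMeasure SU2 L) ^ 2 / softWeight (recordChi L s 43 M β) U) ∂configMeasure SU2 L ≤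
      3 * ((orthoTransverse L Set.univ).toReal * (1 / (Nbar * (1 - κP))) *
        ((Real.exp (2 * β) ^ Fintype.card (Edge 3 L)) ^ 2 * (Real.exp (-(β * (2 - 2 * Real.cos (2 * Real.pi / L)) * (R₀ / 2) ^ 2)) +
            Real.exp (-(τ ^ 2 / powScale 1 β ^ 2)) ^ 2 + Real.exp (-(τ ^ 2 / powScale 1 β ^ 2))) + Real.exp (2 * β) ^ Fintype.card (Edge 3 L) * Ksep) *
        ∫ u, φ u ^ 2 ∂configMeasure SU2 1) := by
  haveI := isFiniteMeasure_orthoTransverse L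
  have hβ0 : 0 ≤ β := by linarith
  obtain ⟨hχm, hχ1, hχ0, hχF⟩ := recordChi_props (L := L) s 43 M β
  obtain ⟨hwm, hwb, hw0, -⟩ := softWeight_recordChi_props (L := L) s 43 M β
  set χ := (recordChi L s 43 M β) with hχdef
  set w := softWeight (recordChi L s 43 M β) with hwdef
  set Ωc : LinkSpace L → ℝ := (fun x : LinkSpace L => {x : LinkSpace L | linkCurry x ∈ capBalancedSet L}.indicator (fun _ => (1 : ℝ)) x * frozenProfile L (fun β' => stiffGaussExp L (β' / 2) β') (fun β' => min (1 / 40) (powScale (1 / 2) β' * btLog β')) β x) with hΩcdef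
  set ε := powScale 1 β with hεdef
  set EK : ℝ := Real.exp (2 * β) ^ Fintype.card (Edge 3 L) with hEKdef
  set cg : ℝ := 1 / (Nbar * (1 - κP)) with hcgdef
  set egf : ℝ := Real.exp (-(τ ^ 2 / ε ^ 2)) with hegfdef
  set eout : ℝ := Real.exp (-(β * (2 - 2 * Real.cos (2 * Real.pi / L)) * (R₀ / 2) ^ 2)) with heoutdef
  set Sout := orthoTubeSet L ∩ {U | χ U ≠ 0} ∩ {U | R₀ < ‖relLinkVec L U‖} with hSoutdef
  set Vin := orthoTubeSet L ∩ {V | ‖relLinkVec L V‖ ≤ R₀ / 2} ∩ {V | ‖(gaugeModes L).starProjection (relLinkVec L V)‖ ≤ τ} ∩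
    {V | ∀ k : Fin 3, ‖su2Quat (slowMean L V (0, k)) - 1‖ ≤ δ} with hVindef
  set PΓ : LinkSpace L → ℝ := fun x => ‖(gaugeModes L).starProjection x‖ with hPΓdef
  have hEK0 : 0 ≤ EK := by positivity
  have hcg0 : 0 < cg := by rw [hcgdef]; exact div_pos one_pos hNκ
  have hqf0 : ∀ β' x, 0 ≤ (fun β' => stiffGaussExp L (β' / 2) β') β' x := fun β' x => stiffGaussExp_nonneg _ _ x
  have hΩGm : Measurable (frozenProfile L (fun β' => stiffGaussExp L (β' / 2) β') (fun β' => min (1 / 40) (powScale (1 / 2) β' * btLog β')) β) := measurable_frozenProfile (fun β' => measurable_stiffGaussExp _ _) _ β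
  have hΩG0 : ∀ x, 0 ≤ frozenProfile L (fun β' => stiffGaussExp L (β' / 2) β') (fun β' => min (1 / 40) (powScale (1 / 2) β' * btLog β')) β x := fun x => (frozenProfile_mem_Icc hqf0 _ β x).1
  have hΩG1 : ∀ x, |frozenProfile L (fun β' => stiffGaussExp L (β' / 2) β') (fun β' => min (1 / 40) (powScale (1 / 2) β' * btLog β')) β x| ≤ 1 := abs_frozenProfile_le hqf0 _ β
  have hΩcm : Measurable Ωc := measurable_capRestrict (L := L) hΩGm
  have hΩc0 : ∀ x, 0 ≤ Ωc x := fun x => (capRestrict_mem (L := L) hΩG0 hΩG1 x).1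
  have hΩc1 : ∀ x, |Ωc x| ≤ 1 := fun x => (capRestrict_mem (L := L) hΩG0 hΩG1 x).2.2
  have hΩcle : ∀ x, Ωc x ≤ 1 := fun x => (le_abs_self _).trans (hΩc1 x)
  have hΩcgauss : ∀ x, Ωc x ≤ Real.exp (-(PΓ x ^ 2 / ε ^ 2)) := fun x => by
    have h1 : Ωc x ≤ frozenProfile L (fun β' => stiffGaussExp L (β' / 2) β') (fun β' => min (1 / 40) (powScale (1 / 2) β' * btLog β')) β x := (capRestrict_mem (L := L) hΩG0 hΩG1 x).2.1
    refine h1.trans ?_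
    unfold frozenProfile
    have h2 : Real.exp (-((fun β' => stiffGaussExp L (β' / 2) β') β x)) ≤ 1 := Real.exp_le_one_iff.mpr (neg_nonpos.mpr (stiffGaussExp_nonneg _ _ _))
    have h3 : (Metric.closedBall (0 : LinkSpace L) ((fun β' => min (1 / 40) (powScale (1 / 2) β' * btLog β')) β)).indicator (fun _ => (1 : ℝ)) x ≤ 1 := by
      by_cases h : x ∈ Metric.closedBall (0 : LinkSpace L) ((fun β' => min (1 / 40) (powScale (1 / 2) β' * btLog β')) β)
      · rw [Set.indicator_of_mem h]
      · rw [Set.indicator_of_notMem h]; exact zero_le_one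
    have h30 : 0 ≤ (Metric.closedBall (0 : LinkSpace L) ((fun β' => min (1 / 40) (powScale (1 / 2) β' * btLog β')) β)).indicator (fun _ => (1 : ℝ)) x := Set.indicator_nonneg (fun _ _ => zero_le_one) _
    calc _ ≤ Real.exp (-(‖(gaugeModes L).starProjection x‖ ^ 2 / powScale 1 β ^ 2)) * 1 * 1 :=
          mul_le_mul (mul_le_mul_of_nonneg_left h2 (Real.exp_pos _).le) h3 h30 (by positivity)
      _ = _ := by rw [mul_one, mul_one]
  set Ωout : LinkSpace L → ℝ := fun x => {x : LinkSpace L | R₀ / 2 < ‖x‖}.indicator (fun _ => (1 : ℝ)) x * Ωc x with hΩoutdef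
  set Ωgf : LinkSpace L → ℝ := fun x => {x : LinkSpace L | ‖x‖ ≤ R₀ / 2}.indicator (fun _ => (1 : ℝ)) x * ({x : LinkSpace L | τ < PΓ x}.indicator (fun _ => (1 : ℝ)) x * Ωc x)
    with hΩgfdef
  set Ωin : LinkSpace L → ℝ := fun x => {x : LinkSpace L | ‖x‖ ≤ R₀ / 2}.indicator (fun _ => (1 : ℝ)) x * ({x : LinkSpace L | PΓ x ≤ τ}.indicator (fun _ => (1 : ℝ)) x * Ωc x)
    with hΩindef
  have hmPΓ : Measurable PΓ := (gaugeModes L).starProjection.continuous.measurable.norm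
  have hmB : MeasurableSet {x : LinkSpace L | ‖x‖ ≤ R₀ / 2} := measurableSet_le measurable_norm measurable_const
  have hΩoutm : Measurable Ωout := (measurable_const.indicator (measurableSet_lt measurable_const measurable_norm)).mul hΩcm
  have hΩgfm : Measurable Ωgf := (measurable_const.indicator hmB).mul ((measurable_const.indicator (measurableSet_lt measurable_const hmPΓ)).mul hΩcm)
  have hΩinm : Measurable Ωin := (measurable_const.indicator hmB).mul ((measurable_const.indicator (measurableSet_le hmPΓ measurable_const)).mul hΩcm)
  have hind01 : ∀ (A : Set (LinkSpace L)) (x : LinkSpace L), 0 ≤ A.indicator (fun _ => (1 : ℝ)) x ∧ A.indicator (fun _ => (1 : ℝ)) x ≤ 1 := fun A x => by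
    by_cases h : x ∈ A
    · rw [Set.indicator_of_mem h]; exact ⟨zero_le_one, le_rfl⟩
    · rw [Set.indicator_of_notMem h]; exact ⟨le_rfl, zero_le_one⟩
  have hΩout0 : ∀ x, 0 ≤ Ωout x := fun x => mul_nonneg (hind01 _ x).1 (hΩc0 x)
  have hΩgf0 : ∀ x, 0 ≤ Ωgf x := fun x => mul_nonneg (hind01 _ x).1 (mul_nonneg (hind01 _ x).1 (hΩc0 x))
  have hΩin0 : ∀ x, 0 ≤ Ωin x := fun x => mul_nonneg (hind01 _ x).1 (mul_nonneg (hind01 _ x).1 (hΩc0 x))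
  have hΩoutle : ∀ x, Ωout x ≤ Ωc x := fun x => by
    have h := mul_le_mul_of_nonneg_right (hind01 {x : LinkSpace L | R₀ / 2 < ‖x‖} x).2 (hΩc0 x); rwa [one_mul] at h
  have hΩgfle : ∀ x, Ωgf x ≤ Ωc x := fun x => by
    have h1 := mul_le_mul_of_nonneg_right (hind01 {x : LinkSpace L | τ < PΓ x} x).2 (hΩc0 x); rw [one_mul] at h1
    have h2 := mul_le_mul (hind01 {x : LinkSpace L | ‖x‖ ≤ R₀ / 2} x).2 h1 (mul_nonneg (hind01 _ x).1 (hΩc0 x)) zero_le_one; rwa [one_mul] at h2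
  have hΩinle : ∀ x, Ωin x ≤ Ωc x := fun x => by
    have h1 := mul_le_mul_of_nonneg_right (hind01 {x : LinkSpace L | PΓ x ≤ τ} x).2 (hΩc0 x); rw [one_mul] at h1
    have h2 := mul_le_mul (hind01 {x : LinkSpace L | ‖x‖ ≤ R₀ / 2} x).2 h1 (mul_nonneg (hind01 _ x).1 (hΩc0 x)) zero_le_one; rwa [one_mul] at h2
  have hΩout1 : ∀ x, |Ωout x| ≤ 1 := fun x => by rw [abs_of_nonneg (hΩout0 x)]; exact (hΩoutle x).trans (hΩcle x)
  have hΩgf1 : ∀ x, |Ωgf x| ≤ 1 := fun x => by rw [abs_of_nonneg (hΩgf0 x)]; exact (hΩgfle x).trans (hΩcle x)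
  have hΩin1 : ∀ x, |Ωin x| ≤ 1 := fun x => by rw [abs_of_nonneg (hΩin0 x)]; exact (hΩinle x).trans (hΩcle x)
  have hΩsum : ∀ x, Ωc x = Ωout x + Ωgf x + Ωin x := fun x => by
    rw [hΩoutdef, hΩgfdef, hΩindef]; dsimp only
    by_cases hA : R₀ / 2 < ‖x‖
    · have hB : x ∉ {x : LinkSpace L | ‖x‖ ≤ R₀ / 2} := fun h => absurd h (not_le.mpr hA)
      rw [Set.indicator_of_mem (show x ∈ {x : LinkSpace L | R₀ / 2 < ‖x‖} from hA), Set.indicator_of_notMem hB]; ring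
    · have hB : x ∈ {x : LinkSpace L | ‖x‖ ≤ R₀ / 2} := not_lt.mp hA
      rw [Set.indicator_of_notMem (show x ∉ {x : LinkSpace L | R₀ / 2 < ‖x‖} from hA), Set.indicator_of_mem hB]
      by_cases hC : τ < PΓ x
      · have hD : x ∉ {x : LinkSpace L | PΓ x ≤ τ} := fun h => absurd h (not_le.mpr hC)
        rw [Set.indicator_of_mem (show x ∈ {x : LinkSpace L | τ < PΓ x} from hC), Set.indicator_of_notMem hD]; ring
      · have hD : x ∈ {x : LinkSpace L | PΓ x ≤ τ} := not_lt.mp hC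
        rw [Set.indicator_of_notMem (show x ∉ {x : LinkSpace L | τ < PΓ x} from hC), Set.indicator_of_mem hD]; ring
  have hbsum : ∀ V, boFun L φ Ωc V = boFun L φ Ωout V + boFun L φ Ωgf V + boFun L φ Ωin V := fun V => by
    unfold boFun; rw [hΩsum]; ring
  have hboutm := measurable_boFun L hφm hΩoutm; have hbgfm := measurable_boFun L hφm hΩgfm; have hbinm := measurable_boFun L hφm hΩinm
  have hboutb : ∀ V, |boFun L φ Ωout V| ≤ Cφ * 1 := fun V => abs_boFun_le L hCφ hΩout1 V
  have hbgfb : ∀ V, |boFun L φ Ωgf V| ≤ Cφ * 1 := fun V => abs_boFun_le L hCφ hΩgf1 V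
  have hbinb : ∀ V, |boFun L φ Ωin V| ≤ Cφ * 1 := fun V => abs_boFun_le L hCφ hΩin1 V
  set Fc : GaugeConfig 3 L SU2 → ℝ := fun U => ∫ V, avgKernel β U V * boFun L φ Ωc V ∂configMeasure SU2 L with hFcdef
  set Fout : GaugeConfig 3 L SU2 → ℝ := fun U => ∫ V, avgKernel β U V * boFun L φ Ωout V ∂configMeasure SU2 L with hFoutdef
  set Fgf : GaugeConfig 3 L SU2 → ℝ := fun U => ∫ V, avgKernel β U V * boFun L φ Ωgf V ∂configMeasure SU2 L with hFgfdef
  set Fin' : GaugeConfig 3 L SU2 → ℝ := fun U => ∫ V, avgKernel β U V * boFun L φ Ωin V ∂configMeasure SU2 L with hFindef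
  have hKi : ∀ (U : GaugeConfig 3 L SU2) {h : GaugeConfig 3 L SU2 → ℝ}, Measurable h → (∀ V, |h V| ≤ Cφ * 1) →
      Integrable (fun V => avgKernel β U V * h V) (configMeasure SU2 L) := fun U h hh hC =>
    integrable_of_measurable_abs_le _ ((measurable_avgKernel_right β U).mul hh) (C := EK * (Cφ * 1)) fun V => by
      rw [abs_mul, abs_of_pos (avgKernel_pos β U V)]
      exact mul_le_mul (avgKernel_le_expCard hβ0 U V) (hC V) (abs_nonneg _) hEK0
  have hFsum : ∀ U, Fc U = Fout U + Fgf U + Fin' U := fun U => by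
    rw [hFcdef, hFoutdef, hFgfdef, hFindef]; dsimp only
    have i12 : Integrable (fun V => avgKernel β U V * boFun L φ Ωout V + avgKernel β U V * boFun L φ Ωgf V) (configMeasure SU2 L) :=
      (hKi U hboutm hboutb).add (hKi U hbgfm hbgfb)
    rw [← integral_add (hKi U hboutm hboutb) (hKi U hbgfm hbgfb), ← integral_add i12 (hKi U hbinm hbinb)]
    refine integral_congr_ae (ae_of_all _ fun V => ?_)
    dsimp only; rw [hbsum]; ring
  obtain ⟨hFoutm, ⟨MFout, hFoutb⟩, -⟩ := integral_avgKernel_mul_props (L := L) β hboutm hboutb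
  obtain ⟨hFgfm, ⟨MFgf, hFgfb⟩, -⟩ := integral_avgKernel_mul_props (L := L) β hbgfm hbgfb
  obtain ⟨hFinm, ⟨MFin, hFinb⟩, -⟩ := integral_avgKernel_mul_props (L := L) β hbinm hbinb
  have hSm : MeasurableSet Sout :=
    ((measurableSet_orthoTubeSet L).inter ((hχm (measurableSet_singleton 0)).compl)).inter (measurableSet_lt measurable_const (measurable_relLinkVec L).norm)
  have hGNm : Measurable fun U : GaugeConfig 3 L SU2 => PΓ (relLinkVec L U) := hmPΓ.comp (measurable_relLinkVec L)
  have hNm : MeasurableSet {U : GaugeConfig 3 L SU2 | PΓ (relLinkVec L U) ≤ τ} := measurableSet_le hGNm measurable_const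
  have hFm' : MeasurableSet {U : GaugeConfig 3 L SU2 | τ < PΓ (relLinkVec L U)} := measurableSet_lt measurable_const hGNm
  set g : GaugeConfig 3 L SU2 → ℝ := fun U => Sout.indicator (fun _ => (1 : ℝ)) U * (w U)⁻¹ with hgdef
  set gn : GaugeConfig 3 L SU2 → ℝ := fun U => {U : GaugeConfig 3 L SU2 | PΓ (relLinkVec L U) ≤ τ}.indicator (fun _ => (1 : ℝ)) U * g U with hgndef
  set gf : GaugeConfig 3 L SU2 → ℝ := fun U => {U : GaugeConfig 3 L SU2 | τ < PΓ (relLinkVec L U)}.indicator (fun _ => (1 : ℝ)) U * g U with hgfdef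
  have hgm : Measurable g := (measurable_const.indicator hSm).mul hwm.inv
  have hgnm : Measurable gn := (measurable_const.indicator hNm).mul hgm; have hgfm : Measurable gf := (measurable_const.indicator hFm').mul hgm
  have hindS01 : ∀ (A : Set (GaugeConfig 3 L SU2)) (U : GaugeConfig 3 L SU2), 0 ≤ A.indicator (fun _ => (1 : ℝ)) U ∧ A.indicator (fun _ => (1 : ℝ)) U ≤ 1 := fun A U => by
    by_cases h : U ∈ A
    · rw [Set.indicator_of_mem h]; exact ⟨zero_le_one, le_rfl⟩
    · rw [Set.indicator_of_notMem h]; exact ⟨le_rfl, zero_le_one⟩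
  have hg0 : ∀ U, 0 ≤ g U := fun U => mul_nonneg (hindS01 _ U).1 (inv_nonneg.2 (hw0 U))
  have hgn0 : ∀ U, 0 ≤ gn U := fun U => mul_nonneg (hindS01 _ U).1 (hg0 U); have hgf0 : ∀ U, 0 ≤ gf U := fun U => mul_nonneg (hindS01 _ U).1 (hg0 U)
  have hgsum : ∀ U, g U = gn U + gf U := fun U => by
    rw [hgndef, hgfdef]; dsimp only
    by_cases h : PΓ (relLinkVec L U) ≤ τ
    · have h' : U ∉ {U : GaugeConfig 3 L SU2 | τ < PΓ (relLinkVec L U)} := fun h2 => absurd h (not_le.mpr h2)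
      rw [Set.indicator_of_mem (show U ∈ {U : GaugeConfig 3 L SU2 | PΓ (relLinkVec L U) ≤ τ} from h), Set.indicator_of_notMem h']; ring
    · have h' : U ∈ {U : GaugeConfig 3 L SU2 | τ < PΓ (relLinkVec L U)} := not_le.mp h
      rw [Set.indicator_of_notMem (show U ∉ {U : GaugeConfig 3 L SU2 | PΓ (relLinkVec L U) ≤ τ} from h), Set.indicator_of_mem h']; ring
  have hgc : ∀ U, g U ≤ cg := fun U => by
    rw [hgdef]; dsimp only
    by_cases hU : U ∈ Sout
    · rw [Set.indicator_of_mem hU, one_mul, hcgdef]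
      exact inv_softWeight_le (χ := χ) ((le_abs_self _).trans (hχ1 U)) hNκ (hPlo U (hχF U hU.1.2).2)
    · rw [Set.indicator_of_notMem hU, zero_mul]; exact hcg0.le
  have hgnc : ∀ U, gn U ≤ cg := fun U => by
    have h := mul_le_mul (hindS01 {U : GaugeConfig 3 L SU2 | PΓ (relLinkVec L U) ≤ τ} U).2 (hgc U) (hg0 U) zero_le_one; rwa [one_mul] at h
  have hgfc : ∀ U, gf U ≤ egf * cg := fun U => by
    rw [hgfdef]; dsimp only
    by_cases hfar : U ∈ {U : GaugeConfig 3 L SU2 | τ < PΓ (relLinkVec L U)}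
    · rw [Set.indicator_of_mem hfar, one_mul, hgdef]; dsimp only
      by_cases hU : U ∈ Sout
      · rw [Set.indicator_of_mem hU, one_mul, inv_softWeight_eq]
        have hUF := (hχF U hU.1.2).2
        have hN := hPlo U hUF
        have hNpos : 0 < gaugeAvg χ U := hNκ.trans_le hN
        have hχle : χ U ≤ egf := by
          rw [hχdef, recordChi_eq_indicator_mul]
          have hi := (hindS01 (fatTubeRho L (fun β => 43 * powScale s β) (fun b => M * (43 * powScale s b)) β) U)
          have hgs : Real.exp (-(gaugeCoordSq L U / powScale 1 β ^ 2)) ≤ egf := by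
            rw [hegfdef]; apply Real.exp_le_exp.2
            have hτ2 : τ ^ 2 ≤ gaugeCoordSq L U := by
              have hlt : τ < PΓ (relLinkVec L U) := hfar
              unfold gaugeCoordSq; exact pow_le_pow_left₀ hτ hlt.le 2
            have hε2 : 0 < ε ^ 2 := pow_pos (powScale_pos _ _) 2
            rw [hεdef] at hε2 ⊢
            have := div_le_div_of_nonneg_right hτ2 hε2.le
            linarith
          calc _ ≤ 1 * egf := mul_le_mul hi.2 hgs (Real.exp_pos _).le zero_le_one
            _ = egf := one_mul _
        calc χ U / gaugeAvg χ U ≤ egf / gaugeAvg χ U := div_le_div_of_nonneg_right hχle hNpos.le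
          _ ≤ egf / (Nbar * (1 - κP)) := div_le_div_of_nonneg_left (Real.exp_pos _).le hNκ hN
          _ = egf * cg := by rw [hcgdef]; ring
      · rw [Set.indicator_of_notMem hU, zero_mul]; positivity
    · rw [Set.indicator_of_notMem hfar, zero_mul]; positivity
  have hgb : ∀ U, |g U| ≤ cg := fun U => by rw [abs_of_nonneg (hg0 U)]; exact hgc U
  have hgnb : ∀ U, |gn U| ≤ cg := fun U => by rw [abs_of_nonneg (hgn0 U)]; exact hgnc U
  have hgfb : ∀ U, |gf U| ≤ egf * cg := fun U => by rw [abs_of_nonneg (hgf0 U)]; exact hgfc U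
  have hSout : ∫ U, g U * Fout U ^ 2 ∂configMeasure SU2 L ≤ EK * (EK * cg) * ∫ V, boFun L φ Ωout V ^ 2 ∂configMeasure SU2 L :=
    schur_avgKernel_restricted_le (L := L) hβ0 hgm hgb hg0 hboutm hboutb MeasurableSet.univ (fun V _ => Set.mem_univ V) (by positivity)
      (fun V _ => integral_avgKernel_mul_le_of_le hβ0 hg0 hgc V)
  have hSgf : ∫ U, g U * Fgf U ^ 2 ∂configMeasure SU2 L ≤ EK * (EK * cg) * ∫ V, boFun L φ Ωgf V ^ 2 ∂configMeasure SU2 L :=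
    schur_avgKernel_restricted_le (L := L) hβ0 hgm hgb hg0 hbgfm hbgfb MeasurableSet.univ (fun V _ => Set.mem_univ V) (by positivity)
      (fun V _ => integral_avgKernel_mul_le_of_le hβ0 hg0 hgc V)
  have hSfar : ∫ U, gf U * Fin' U ^ 2 ∂configMeasure SU2 L ≤ EK * (EK * (egf * cg)) * ∫ V, boFun L φ Ωin V ^ 2 ∂configMeasure SU2 L :=
    schur_avgKernel_restricted_le (L := L) hβ0 hgfm hgfb hgf0 hbinm hbinb MeasurableSet.univ (fun V _ => Set.mem_univ V) (by positivity)
      (fun V _ => integral_avgKernel_mul_le_of_le hβ0 hgf0 hgfc V)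
  have hVinm : MeasurableSet Vin := by
    rw [hVindef]
    refine (((measurableSet_orthoTubeSet L).inter (measurableSet_le (measurable_relLinkVec L).norm measurable_const)).inter hNm).inter ?_
    have h : {V : GaugeConfig 3 L SU2 | ∀ k : Fin 3, ‖su2Quat (slowMean L V (0, k)) - 1‖ ≤ δ} = ⋂ k : Fin 3, {V | ‖su2Quat (slowMean L V (0, k)) - 1‖ ≤ δ} := by
      ext V; simp
    rw [h]
    exact MeasurableSet.iInter fun k => measurableSet_le
      ((continuous_norm.comp (Literature.MathematicalPhysics.QuantumFieldTheory.Balaban1983to89.T4HaarSU2Translate.continuous_su2Quat.sub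
        continuous_const)).measurable.comp ((measurable_pi_apply (((0 : Site 3 1), k) : Edge 3 1)).comp (measurable_slowMean L))) measurable_const
  have hfinV : ∀ V, boFun L φ Ωin V ≠ 0 → V ∈ Vin := by
    intro V hV
    by_cases hVT : V ∈ orthoTubeSet L
    · have hVT' := hVT
      obtain ⟨u, v, hv, rfl⟩ := hVT'
      rw [boFun_orthoTube L φ Ωin u hv] at hV
      have hφu : φ u ≠ 0 := left_ne_zero_of_mul hV
      have hΩv : Ωin (linkEmbed L v) ≠ 0 := right_ne_zero_of_mul hV
      have h1 : linkEmbed L v ∈ {x : LinkSpace L | ‖x‖ ≤ R₀ / 2} := by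
        by_contra h; apply hΩv; rw [hΩindef]; dsimp only; rw [Set.indicator_of_notMem h, zero_mul]
      have h2 : linkEmbed L v ∈ {x : LinkSpace L | PΓ x ≤ τ} := by
        by_contra h; apply hΩv; rw [hΩindef]; dsimp only; rw [Set.indicator_of_notMem h, zero_mul, mul_zero]
      rw [hVindef]
      refine ⟨⟨⟨hVT, ?_⟩, ?_⟩, ?_⟩
      · show ‖relLinkVec L (orthoTube L u v)‖ ≤ R₀ / 2
        rw [relLinkVec_orthoTube L u hv]; exact h1
      · show PΓ (relLinkVec L (orthoTube L u v)) ≤ τ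
        rw [relLinkVec_orthoTube L u hv]; exact h2
      · show ∀ k : Fin 3, ‖su2Quat (slowMean L (orthoTube L u v) (0, k)) - 1‖ ≤ δ
        rw [slowMean_orthoTube L u hv]; exact hφw u hφu
    · exact absurd (boFun_eq_zero_of_not_mem L φ Ωin hVT) hV
  have hSnear : ∫ U, gn U * Fin' U ^ 2 ∂configMeasure SU2 L ≤ EK * (Ksep * cg) * ∫ V, boFun L φ Ωin V ^ 2 ∂configMeasure SU2 L := by
    refine schur_avgKernel_restricted_le (L := L) hβ0 hgnm hgnb hgn0 hbinm hbinb hVinm hfinV (by positivity) fun V hV => ?_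
    refine integral_avgKernel_mul_le_of_sep hgn0 hgnc hKsep V fun U hU => ?_
    have hUn : U ∈ {U : GaugeConfig 3 L SU2 | PΓ (relLinkVec L U) ≤ τ} := by
      by_contra h; apply hU; rw [hgndef]; dsimp only; rw [Set.indicator_of_notMem h, zero_mul]
    have hUS : U ∈ Sout := by
      by_contra h; apply hU; rw [hgndef, hgdef]; dsimp only; rw [Set.indicator_of_notMem h, zero_mul, mul_zero]
    exact hsep U hUS hUn V hV
  have hMout : ∫ V, boFun L φ Ωout V ^ 2 ∂configMeasure SU2 L ≤ (orthoTransverse L Set.univ).toReal * eout * ∫ u, φ u ^ 2 ∂configMeasure SU2 1 := by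
    refine sq_integral_boFun_le (L := L) hφm hCφ hΩoutm hΩout1 (Real.exp_pos _).le fun v hv => ?_
    rw [hΩoutdef]; dsimp only
    by_cases hA : linkEmbed L v ∈ {x : LinkSpace L | R₀ / 2 < ‖x‖}
    · rw [Set.indicator_of_mem hA, one_mul]
      have hR : R₀ / 2 < ‖linkEmbed L v‖ := hA
      have hcap : linkEmbed L v ∈ {x : LinkSpace L | linkCurry x ∈ capBalancedSet L} := (linkEmbed_mem_capLink_iff v).2 hv
      have e : Ωc (linkEmbed L v) = frozenProfile L (fun β' => stiffGaussExp L (β' / 2) β') (fun β' => min (1 / 40) (powScale (1 / 2) β' * btLog β')) β (linkEmbed L v) := by rw [hΩcdef]; dsimp only; rw [Set.indicator_of_mem hcap, one_mul]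
      rw [e]
      have hshell := shell_integrand_le_of_hodge (L := L) hL ker_covCurl_one_le hβ hβg hv.1 (by positivity : 0 ≤ R₀ / 2) hR
      unfold frozenProfile
      have h3 := (hind01 (Metric.closedBall (0 : LinkSpace L) ((fun β' => min (1 / 40) (powScale (1 / 2) β' * btLog β')) β)) (linkEmbed L v))
      have hg1 : Real.exp (-(‖(gaugeModes L).starProjection (linkEmbed L v)‖ ^ 2 / powScale 1 β ^ 2)) ≤ 1 :=
        Real.exp_le_one_iff.mpr (neg_nonpos.mpr (by positivity))
      calc (Real.exp (-(‖(gaugeModes L).starProjection (linkEmbed L v)‖ ^ 2 / powScale 1 β ^ 2)) * Real.exp (-((fun β' => stiffGaussExp L (β' / 2) β') β (linkEmbed L v))) *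
            (Metric.closedBall (0 : LinkSpace L) ((fun β' => min (1 / 40) (powScale (1 / 2) β' * btLog β')) β)).indicator (fun _ => (1 : ℝ)) (linkEmbed L v)) ^ 2
          ≤ (Real.exp (-(‖(gaugeModes L).starProjection (linkEmbed L v)‖ ^ 2 / powScale 1 β ^ 2)) * Real.exp (-(stiffGaussExp L (β / 2) β (linkEmbed L v))) * 1) ^ 2 := by
            gcongr
            · exact mul_nonneg (mul_nonneg (Real.exp_pos _).le (Real.exp_pos _).le) h3.1
            · exact h3.2
        _ = Real.exp (-(‖(gaugeModes L).starProjection (linkEmbed L v)‖ ^ 2 / powScale 1 β ^ 2)) *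
              (Real.exp (-(stiffGaussExp L (β / 2) β (linkEmbed L v))) ^ 2 * Real.exp (-(‖(gaugeModes L).starProjection (linkEmbed L v)‖ ^ 2 / powScale 1 β ^ 2))) := by ring
        _ ≤ 1 * Real.exp (-(β * (2 - 2 * Real.cos (2 * Real.pi / L)) * (R₀ / 2) ^ 2)) := mul_le_mul hg1 hshell (by positivity) zero_le_one
        _ = eout := one_mul _
    · rw [Set.indicator_of_notMem hA, zero_mul]; simp [heoutdef, (Real.exp_pos _).le]
  have hMgf : ∫ V, boFun L φ Ωgf V ^ 2 ∂configMeasure SU2 L ≤ (orthoTransverse L Set.univ).toReal * egf ^ 2 * ∫ u, φ u ^ 2 ∂configMeasure SU2 1 := by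
    refine sq_integral_boFun_le (L := L) hφm hCφ hΩgfm hΩgf1 (sq_nonneg _) fun v _ => ?_
    rw [hΩgfdef]; dsimp only
    by_cases hC : linkEmbed L v ∈ {x : LinkSpace L | τ < PΓ x}
    · have hlt : τ < PΓ (linkEmbed L v) := hC
      have hle : Ωc (linkEmbed L v) ≤ egf := (hΩcgauss _).trans (Real.exp_le_exp.2 (by
        have hε2 : 0 < ε ^ 2 := pow_pos (powScale_pos _ _) 2
        have := div_le_div_of_nonneg_right (pow_le_pow_left₀ hτ hlt.le 2) hε2.le
        linarith))
      have h1 := hind01 {x : LinkSpace L | ‖x‖ ≤ R₀ / 2} (linkEmbed L v)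
      rw [Set.indicator_of_mem hC, one_mul]
      calc ({x : LinkSpace L | ‖x‖ ≤ R₀ / 2}.indicator (fun _ => (1 : ℝ)) (linkEmbed L v) * Ωc (linkEmbed L v)) ^ 2 ≤ (1 * egf) ^ 2 :=
            pow_le_pow_left₀ (mul_nonneg h1.1 (hΩc0 _)) (mul_le_mul h1.2 hle (hΩc0 _) zero_le_one) 2
        _ = egf ^ 2 := by rw [one_mul]
    · rw [Set.indicator_of_notMem hC, zero_mul, mul_zero]
      simp only [ne_eq, OfNat.ofNat_ne_zero, not_false_eq_true, zero_pow]; exact sq_nonneg _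
  have hMin : ∫ V, boFun L φ Ωin V ^ 2 ∂configMeasure SU2 L ≤ (orthoTransverse L Set.univ).toReal * 1 * ∫ u, φ u ^ 2 ∂configMeasure SU2 1 :=
    sq_integral_boFun_le (L := L) hφm hCφ hΩinm hΩin1 zero_le_one fun v _ => by
      rw [← sq_abs]; exact pow_le_one₀ (abs_nonneg _) (hΩin1 _)
  have hptI : ∀ U, Sout.indicator (fun _ => (1 : ℝ)) U * (Fc U ^ 2 / w U) ≤ 3 * (g U * Fout U ^ 2) + 3 * (g U * Fgf U ^ 2) + (3 * (gn U * Fin' U ^ 2) + 3 * (gf U * Fin' U ^ 2)) := by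
    intro U
    have e : Sout.indicator (fun _ => (1 : ℝ)) U * (Fc U ^ 2 / w U) = g U * Fc U ^ 2 := by rw [hgdef]; dsimp only; rw [div_eq_mul_inv]; ring
    rw [e, hFsum U]
    have h3 : (Fout U + Fgf U + Fin' U) ^ 2 ≤ 3 * (Fout U ^ 2 + Fgf U ^ 2 + Fin' U ^ 2) := by
      nlinarith [sq_nonneg (Fout U - Fgf U), sq_nonneg (Fout U - Fin' U), sq_nonneg (Fgf U - Fin' U)]
    have h4 := mul_le_mul_of_nonneg_left h3 (hg0 U)
    have e2 : g U * (3 * (Fout U ^ 2 + Fgf U ^ 2 + Fin' U ^ 2)) = 3 * (g U * Fout U ^ 2) + 3 * (g U * Fgf U ^ 2) + (3 * (gn U * Fin' U ^ 2) + 3 * (gf U * Fin' U ^ 2)) := by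
      rw [show g U * Fout U ^ 2 = g U * Fout U ^ 2 from rfl, hgsum U]; ring
    linarith
  have hIi : ∀ {a : GaugeConfig 3 L SU2 → ℝ} {Ca : ℝ} {G : GaugeConfig 3 L SU2 → ℝ} {MG : ℝ}, Measurable a → (∀ U, |a U| ≤ Ca) → Measurable G → (∀ U, |G U| ≤ MG) →
      Integrable (fun U => a U * G U ^ 2) (configMeasure SU2 L) := fun {a} {Ca} {G} {MG} ham haC hGm hGb =>
    integrable_of_measurable_abs_le _ (ham.mul (hGm.pow_const 2)) (C := Ca * MG ^ 2) fun U => by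
      rw [abs_mul, abs_pow]
      exact mul_le_mul (haC U) (pow_le_pow_left₀ (abs_nonneg _) (hGb U) 2) (by positivity) ((abs_nonneg _).trans (haC U))
  have i1 := (hIi hgm hgb hFoutm hFoutb).const_mul 3; have i2 := (hIi hgm hgb hFgfm hFgfb).const_mul 3
  have i3 := (hIi hgnm hgnb hFinm hFinb).const_mul 3; have i4 := (hIi hgfm hgfb hFinm hFinb).const_mul 3
  have i12 : Integrable (fun U => 3 * (g U * Fout U ^ 2) + 3 * (g U * Fgf U ^ 2)) (configMeasure SU2 L) := i1.add i2
  have i34 : Integrable (fun U => 3 * (gn U * Fin' U ^ 2) + 3 * (gf U * Fin' U ^ 2)) (configMeasure SU2 L) := i3.add i4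
  have hnn : ∀ U, 0 ≤ Sout.indicator (fun _ => (1 : ℝ)) U * (Fc U ^ 2 / w U) := fun U => mul_nonneg (hindS01 _ U).1 (div_nonneg (sq_nonneg _) (hw0 U))
  have hmain : ∫ U, Sout.indicator (fun _ => (1 : ℝ)) U * (Fc U ^ 2 / w U) ∂configMeasure SU2 L ≤
      3 * (EK * (EK * cg) * ((orthoTransverse L Set.univ).toReal * eout * ∫ u, φ u ^ 2 ∂configMeasure SU2 1)) +
      3 * (EK * (EK * cg) * ((orthoTransverse L Set.univ).toReal * egf ^ 2 * ∫ u, φ u ^ 2 ∂configMeasure SU2 1)) +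
      (3 * (EK * (Ksep * cg) * ((orthoTransverse L Set.univ).toReal * 1 * ∫ u, φ u ^ 2 ∂configMeasure SU2 1)) +
        3 * (EK * (EK * (egf * cg)) * ((orthoTransverse L Set.univ).toReal * 1 * ∫ u, φ u ^ 2 ∂configMeasure SU2 1))) := by
    calc ∫ U, Sout.indicator (fun _ => (1 : ℝ)) U * (Fc U ^ 2 / w U) ∂configMeasure SU2 L
        ≤ ∫ U, 3 * (g U * Fout U ^ 2) + 3 * (g U * Fgf U ^ 2) + (3 * (gn U * Fin' U ^ 2) + 3 * (gf U * Fin' U ^ 2)) ∂configMeasure SU2 L :=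
          integral_mono_of_nonneg (ae_of_all _ hnn) (i12.add i34) (ae_of_all _ hptI)
      _ = 3 * ∫ U, g U * Fout U ^ 2 ∂configMeasure SU2 L + 3 * ∫ U, g U * Fgf U ^ 2 ∂configMeasure SU2 L +
            (3 * ∫ U, gn U * Fin' U ^ 2 ∂configMeasure SU2 L + 3 * ∫ U, gf U * Fin' U ^ 2 ∂configMeasure SU2 L) := by
          rw [integral_add i12 i34, integral_add i1 i2, integral_add i3 i4, integral_const_mul, integral_const_mul, integral_const_mul, integral_const_mul]
      _ ≤ _ := by
          have hm1 : 0 ≤ EK * (EK * cg) := by positivity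
          have hm3 : 0 ≤ EK * (Ksep * cg) := by positivity
          have hm4 : 0 ≤ EK * (EK * (egf * cg)) := by positivity
          gcongr
          · exact hSout.trans (mul_le_mul_of_nonneg_left hMout hm1)
          · exact hSgf.trans (mul_le_mul_of_nonneg_left hMgf hm1)
          · exact hSnear.trans (mul_le_mul_of_nonneg_left hMin hm3)
          · exact hSfar.trans (mul_le_mul_of_nonneg_left hMin hm4)
  refine hmain.trans (le_of_eq ?_)
  rw [hcgdef]; ring

end Summit.QuantumFields.YangMills.Theorems.FemtoTransferGap.TwoLattice.ConstTube

end
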